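import Summits.ResolutionOfSingularities.ResolutionOfSingularities.Theorems.MarkedTransferCampaignW46MohWindowShadeAnchor
import HarnessLib

/-!
# [OURS · L1 W4.6 rung (iii-2), ENTRANCE DOOR, brick 5] A CLEANED anchor polynomial of order `p` admits no window exponent `> p`:
# the bottom edge of the model is the bottom edge of the intrinsic residual order

Cell `res-hironaka`, LADDER-RESOLUTION rung L (D-0089), slot W4.6 rung (iii); seat res-L1-s46-pv-6 (gen 4). Host route MarkedTransfer,
`--supports stmt-ResolutionOfSingularities-16155 --as helper`; kind proof (no definition).

WHY. o1's regime asks at every singular point for a window presentation with exponent `d > p` (`MohWindowSurfaceAt p R J`: `residualOrder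
= d`, res-D-pv-008 / res-D-pv-050). The ENTRANCE DOOR (`…AnchorStep`) produces upstairs the anchor `J′ = (z′^p + F′(x′, y′))` with `F′` the
model's `PointBlowup.step` — CLEANED — and singularity only gives `p ≤ ord₀ F′`. This brick closes the gap `ord₀ F′ ≠ p` FROM the regime:
**`not_le_span_pow_sup_of_cleaned`** — if `F` is cleaned with `ord₀ F = p`, `(x, y, z)` a regular system of parameters and the constants
residually onto, then for NO `w ∈ 𝔪` is `(z^p + F(x, y)) ⊆ (w^p) + 𝔪^(p+1)` (degree-`p` forms: `w ≡ ℓ` linear mod `𝔪²`, `w^p ≡ ℓ^p =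
Σ t_l^p X_l^p` mod `𝔪^(p+1)`, so the degree-`p` part of `F` would be supported on `p`-th power monomials — excluded by cleanedness;
quasi-regularity via `…Anchor.natCast_le_ordZero_of_eval₂_mem_pow`). Consequence **`ordZero_ne_of_mohWindowSurfaceAt`**: at a point of o1's
regime a cleaned anchor polynomial has `ord₀ F ≠ p`, hence (with singularity) `p < ord₀ F` — so the model's residual order IS the window
exponent and the polynomial sub-regime `Regime.mohWindowSurfacePoly` PROPAGATES along blow-ups (`…MohWindowShadePolyPersistence.lean`).

HONEST FRAMING. Nothing here is a statement of H. Hironaka's manuscript [Hironaka2017] (2017-03-23 — scope only, under adjudication) and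
nothing asserts that any statement of it holds. AI-written; AI review is weaker than expert review. No `sorry`; axioms standard.
References: H. Matsumura, *Commutative Ring Theory* (1986), Thm. 16.2 (i); H. Hauser, Bull. AMS 47 (2010) §G (cleaning). [Matsumura1987]
[Hauser2010] [folklore]
-/

noncomputable section

set_option linter.dupNamespace false -- mandated namespace of this single-conjunct summit

open IsLocalRing MvPolynomial

namespace Summit.ResolutionOfSingularities.ResolutionOfSingularities.Theorems

namespace CampaignW46

namespace MohWindowShadeAnchorOrder

open Literature.AlgebraicGeometry.Resolution
open Literature.AlgebraicGeometry.Resolution.Hauser2010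
open Literature.Barriers.ResolutionOfSingularities.HauserPerlega (natCast_le_ordZero_iff ordZero_ne_top ordZero_rename)

universe u v

variable {R : Type u} [CommRing R] [IsLocalRing R] {K : Type v} [Field K]
variable {σ : Type*} [DecidableEq σ] {j i : σ}

/-- A cleaned polynomial has no `p`-th power monomial in its support. [cite: Hauser2010, §G (cleaning of p-th power monomials)] -/
theorem not_isPthPowerExponent_of_cleaned {p : ℕ} {F : MvPolynomial σ K} (hclean : deletePthPowers p F = F)
    {d : σ →₀ ℕ} (hd : d ∈ F.support) : ¬ IsPthPowerExponent p d := by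
  classical
  intro hP
  rw [← hclean, MvPolynomial.mem_support_iff, coeff_deletePthPowers, if_pos hP] at hd
  exact hd rfl

/-- `single l p` is a `p`-th power exponent. [folklore] -/
theorem isPthPowerExponent_single {τ : Type*} (p : ℕ) (l : τ) : IsPthPowerExponent p (Finsupp.single l p) := by
  classical
  rw [isPthPowerExponent_iff]
  intro l'
  by_cases h : l = l'
  · subst h; rw [Finsupp.single_eq_same]
  · rw [Finsupp.single_apply, if_neg h]; exact dvd_zero p

omit [DecidableEq σ] in
/-- Renaming along an injective map preserves «not a `p`-th power exponent». [folklore] -/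
theorem isPthPowerExponent_of_mapDomain {τ : Type*} {ι : σ → τ} (hι : Function.Injective ι) {p : ℕ} {d : σ →₀ ℕ}
    (h : IsPthPowerExponent p (Finsupp.mapDomain ι d)) : IsPthPowerExponent p d := by
  rw [isPthPowerExponent_iff] at h ⊢
  intro l
  have := h (ι l)
  rwa [Finsupp.mapDomain_apply hι] at this

/-- An element of `𝔪 = (x, y, z)` is a `K`-linear form in `(x, y, z)` plus an element of `𝔪²`, when the constants are residually onto.
[folklore] -/
theorem exists_linear_add_mem_sq {x y z : R} (hxyz : Ideal.span {x, y, z} = maximalIdeal R) (κ : K →+* R)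
    (hrat : ∀ r : R, ∃ t : K, r - κ t ∈ maximalIdeal R) {w : R} (hw : w ∈ maximalIdeal R) :
    ∃ (t₁ t₂ t₃ : K) (q : R), q ∈ maximalIdeal R ^ 2 ∧ w = κ t₁ * x + κ t₂ * y + κ t₃ * z + q := by
  rw [← hxyz] at hw
  obtain ⟨r₁, r₂, r₃, hw⟩ := Submodule.mem_span_triple.mp hw
  obtain ⟨t₁, h₁⟩ := hrat r₁
  obtain ⟨t₂, h₂⟩ := hrat r₂
  obtain ⟨t₃, h₃⟩ := hrat r₃
  have hx : x ∈ maximalIdeal R := hxyz ▸ Ideal.subset_span (Set.mem_insert _ _)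
  have hy : y ∈ maximalIdeal R := hxyz ▸ Ideal.subset_span (Set.mem_insert_of_mem _ (Set.mem_insert _ _))
  have hz : z ∈ maximalIdeal R := hxyz ▸ Ideal.subset_span (Set.mem_insert_of_mem _ (Set.mem_insert_of_mem _ (Set.mem_singleton _)))
  refine ⟨t₁, t₂, t₃, (r₁ - κ t₁) * x + (r₂ - κ t₂) * y + (r₃ - κ t₃) * z, ?_, ?_⟩
  · rw [pow_two]
    exact Ideal.add_mem _ (Ideal.add_mem _ (Ideal.mul_mem_mul h₁ hx) (Ideal.mul_mem_mul h₂ hy)) (Ideal.mul_mem_mul h₃ hz)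
  · rw [← hw]; simp only [smul_eq_mul]; ring

/-- **The bottom edge.** `R` regular local of embedding dimension `3`, characteristic `p`, `(x, y, z)` generating `𝔪`, constants `κ : K → R`
residually onto; `F ∈ K[y_j, y_i]` CLEANED with `ord₀ F = p`. Then for no `w ∈ 𝔪` does `(z^p + F(x, y)) ⊆ (w^p) + 𝔪^(p+1)` hold:
the residual order of the anchored ideal is exactly `p`, so the germ admits no window presentation of exponent `> p`. NOT a statement of
the manuscript. [cite: Matsumura1987, Thm. 16.2 (i)] [cite: Hauser2010, §G (cleaning of p-th power monomials)] -/
theorem not_le_span_pow_sup_of_cleaned {p : ℕ} [Fact p.Prime] [CharP R p] [CharP K p] (hR : IsRegularLocalRing R)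
    (h3 : (maximalIdeal R).spanFinrank = 3) {x y z : R} (hxyz : Ideal.span {x, y, z} = maximalIdeal R) (κ : K →+* R)
    (hrat : ∀ r : R, ∃ t : K, r - κ t ∈ maximalIdeal R) (hij : i ≠ j) (htwo : ∀ l, l = j ∨ l = i)
    {F : MvPolynomial σ K} (hclean : deletePthPowers p F = F) (ho : ordZero F = p) {w : R} (hw : w ∈ maximalIdeal R) :
    ¬ Ideal.span {z ^ p + eval₂ κ (fun l => if l = j then x else y) F} ≤ Ideal.span {w ^ p} ⊔ maximalIdeal R ^ (p + 1) := by
  classical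
  intro hle
  have hp1 : 1 ≤ p := (Fact.out : p.Prime).one_lt.le
  -- `z^p + F(x,y) = a w^p + m`, `m ∈ 𝔪^(p+1)`
  obtain ⟨a, m, hm, hgen⟩ := Ideal.mem_span_singleton_sup.mp (hle (Ideal.mem_span_singleton_self _))
  obtain ⟨a₀, ha₀⟩ := hrat a
  obtain ⟨t₁, t₂, t₃, q, hq, hwq⟩ := exists_linear_add_mem_sq hxyz κ hrat hw
  -- the linear form and its `p`-th power
  set ι : σ → Fin 3 := fun l => if l = j then (0 : Fin 3) else 1 with hι
  set L : MvPolynomial (Fin 3) K := C t₁ * X 0 + C t₂ * X 1 + C t₃ * X 2 with hL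
  have hLev : eval₂ κ ![x, y, z] L = κ t₁ * x + κ t₂ * y + κ t₃ * z := by
    simp only [hL, eval₂_add, eval₂_mul, eval₂_C, eval₂_X, Matrix.cons_val_zero, Matrix.cons_val_one, Matrix.head_cons,
      Matrix.cons_val_two, Matrix.tail_cons]
  have hLp : L ^ p = C (t₁ ^ p) * X 0 ^ p + C (t₂ ^ p) * X 1 ^ p + C (t₃ ^ p) * X 2 ^ p := by
    rw [hL, add_pow_char _ _ p, add_pow_char _ _ p, mul_pow, mul_pow, mul_pow, ← map_pow, ← map_pow, ← map_pow]
  -- the `K`-polynomial `Ψ = X₂^p + F − a₀ L^p` evaluates into `𝔪^(p+1)`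
  set Ψ : MvPolynomial (Fin 3) K := X 2 ^ p + rename ι F - C a₀ * L ^ p with hΨ
  have hw_p : w ^ p = (κ t₁ * x + κ t₂ * y + κ t₃ * z) ^ p + q ^ p := by rw [hwq, add_pow_char _ _ p]
  have hx : x ∈ maximalIdeal R := hxyz ▸ Ideal.subset_span (Set.mem_insert _ _)
  have hqp : q ^ p ∈ maximalIdeal R ^ (p + 1) := by
    have : q ^ p ∈ (maximalIdeal R ^ 2) ^ p := Ideal.pow_mem_pow hq p
    rw [← pow_mul] at this
    exact Ideal.pow_le_pow_right (by omega) this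
  have hwp_mem : w ^ p ∈ maximalIdeal R ^ p := Ideal.pow_mem_pow hw p
  have hev : eval₂ κ ![x, y, z] Ψ ∈ maximalIdeal R ^ (p + 1) := by
    have hΨev : eval₂ κ ![x, y, z] Ψ =
        z ^ p + eval₂ κ (fun l => if l = j then x else y) F - κ a₀ * (κ t₁ * x + κ t₂ * y + κ t₃ * z) ^ p := by
      rw [hΨ, eval₂_sub, eval₂_add, eval₂_mul, eval₂_pow, eval₂_pow, eval₂_C, eval₂_X, hLev,
        MohWindowShadeAnchor.eval₂_rename_frame]
      rfl
    rw [hΨev, ← hgen]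
    -- `a w^p + m − κ a₀ ℓ^p = (a − κ a₀) w^p + κ a₀ q^p + m`
    have : a * w ^ p + m - κ a₀ * (κ t₁ * x + κ t₂ * y + κ t₃ * z) ^ p =
        (a - κ a₀) * w ^ p + κ a₀ * q ^ p + m := by rw [hw_p]; ring
    rw [this]
    refine Ideal.add_mem _ (Ideal.add_mem _ ?_ (Ideal.mul_mem_left _ _ hqp)) hm
    have := Ideal.mul_mem_mul ha₀ hwp_mem
    rwa [← pow_succ'] at this
  have hord := MohWindowShadeAnchor.natCast_le_ordZero_of_eval₂_mem_pow hR h3 hxyz κ hev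
  -- a monomial of `F` of degree `p`, renamed, survives in `Ψ` with degree `p < p + 1`: contradiction
  have hF0 : F ≠ 0 := by rintro rfl; rw [ordZero_zero] at ho; exact ENat.top_ne_coe _ ho
  obtain ⟨⟨μ, hμ, hμdeg⟩, -⟩ := (ordZero_eq_nat_iff F p).mp ho
  have hμsupp : μ ∈ F.support := MvPolynomial.mem_support_iff.mpr hμ
  have hnot : ¬ IsPthPowerExponent p μ := not_isPthPowerExponent_of_cleaned hclean hμsupp
  have hιinj : Function.Injective ι := MohWindowShadeAnchor.frame_rename_injective hij htwo
  have hnot' : ¬ IsPthPowerExponent p (Finsupp.mapDomain ι μ) := fun h => hnot (isPthPowerExponent_of_mapDomain hιinj h)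
  have hne : ∀ l : Fin 3, Finsupp.single l p ≠ Finsupp.mapDomain ι μ := fun l h => hnot' (h ▸ isPthPowerExponent_single p l)
  have hcoeff : coeff (Finsupp.mapDomain ι μ) Ψ = coeff μ F := by
    rw [hΨ, coeff_sub, coeff_add, coeff_X_pow, if_neg (hne 2), zero_add, coeff_rename_mapDomain ι hιinj, hLp,
      coeff_C_mul, coeff_add, coeff_add, coeff_C_mul, coeff_C_mul, coeff_C_mul, coeff_X_pow, coeff_X_pow, coeff_X_pow,
      if_neg (hne 0), if_neg (hne 1), if_neg (hne 2)]
    ring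
  have hμ'supp : Finsupp.mapDomain ι μ ∈ Ψ.support := by rw [MvPolynomial.mem_support_iff, hcoeff]; exact hμ
  have hdeg' : (Finsupp.mapDomain ι μ).degree = p := by rw [Finsupp.degree_mapDomain, hμdeg]
  have := (natCast_le_ordZero_iff Ψ (p + 1)).mp hord _ hμ'supp
  omega

/-- **`ord₀ F ≠ p` inside o1's regime.** If the anchored ideal `(z^p + F(x, y))` (cleaned `F`) is a surface window germ of exponent `p` in
o1's sense (`MohWindowSurfaceAt p R ·`: SOME presentation with exponent `p < d < 2p`, so that `d` is admissible for the residual order by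
res-D-pv-008's `isGreatest_window_exponent`), then `ord₀ F ≠ p`. NOT a statement of the manuscript. [folklore] -/
theorem ordZero_ne_of_mohWindowSurfaceAt {p : ℕ} [Fact p.Prime] [CharP R p] [CharP K p] (hR : IsRegularLocalRing R)
    (h3 : (maximalIdeal R).spanFinrank = 3) {x y z : R} (hxyz : Ideal.span {x, y, z} = maximalIdeal R) (κ : K →+* R)
    (hrat : ∀ r : R, ∃ t : K, r - κ t ∈ maximalIdeal R) (hij : i ≠ j) (htwo : ∀ l, l = j ∨ l = i)
    {F : MvPolynomial σ K} (hclean : deletePthPowers p F = F)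
    (hwin : MohWindowSurfaceAt p R (Ideal.span {z ^ p + eval₂ κ (fun l => if l = j then x else y) F})) :
    ordZero F ≠ p := by
  intro ho
  obtain ⟨hR', h3', x', y', z', hxyz', d, a, hpd, hd2, hunit, hI⟩ := hwin.coeffAt
  have hG := MohWindowSurfaceResidualOrder.isGreatest_window_exponent p hR' h3' hxyz' hpd hd2
    (MohWindowSurface.coeffForm_mem_span_pow x' y' d a) (MohWindowSurface.coeffForm_not_mem_pow_succ hR' h3' hxyz' hunit) (z := z')
  obtain ⟨w, hw, hle⟩ := hG.1
  rw [← hI] at hle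
  have hle' : Ideal.span {z ^ p + eval₂ κ (fun l => if l = j then x else y) F} ≤ Ideal.span {w ^ p} ⊔ maximalIdeal R ^ (p + 1) :=
    hle.trans (sup_le_sup_left (Ideal.pow_le_pow_right hpd) _)
  exact not_le_span_pow_sup_of_cleaned hR h3 hxyz κ hrat hij htwo hclean ho hw hle'

/-- **The window, strict at the bottom**: at a SINGULAR point of o1's regime (the anchored ideal lies in `𝔪^p` and is a window germ of
exponent `p`), a cleaned anchor polynomial has `p < ord₀ F < 2p`. NOT a statement of the manuscript. [folklore] -/
theorem window_strict_of_cleaned {p : ℕ} [Fact p.Prime] [CharP R p] [CharP K p] (hR : IsRegularLocalRing R)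
    (h3 : (maximalIdeal R).spanFinrank = 3) {x y z : R} (hxyz : Ideal.span {x, y, z} = maximalIdeal R) (κ : K →+* R)
    (hrat : ∀ r : R, ∃ t : K, r - κ t ∈ maximalIdeal R) (hij : i ≠ j) (htwo : ∀ l, l = j ∨ l = i)
    {F : MvPolynomial σ K} (hclean : deletePthPowers p F = F) (hF0 : F ≠ 0)
    (hsing : Ideal.span {z ^ p + eval₂ κ (fun l => if l = j then x else y) F} ≤ maximalIdeal R ^ p)
    (hwin : MohWindowSurfaceAt p R (Ideal.span {z ^ p + eval₂ κ (fun l => if l = j then x else y) F})) :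
    (p : ℕ∞) < ordZero F ∧ ordZero F < (2 * p : ℕ) := by
  have hx : x ∈ maximalIdeal R := hxyz ▸ Ideal.subset_span (Set.mem_insert _ _)
  have hy : y ∈ maximalIdeal R := hxyz ▸ Ideal.subset_span (Set.mem_insert_of_mem _ (Set.mem_insert _ _))
  have hz : z ∈ maximalIdeal R := hxyz ▸ Ideal.subset_span (Set.mem_insert_of_mem _ (Set.mem_insert_of_mem _ (Set.mem_singleton _)))
  have hle := MohWindowShadeAnchor.natCast_le_ordZero_of_span_le_pow₂ hR h3 hxyz κ hij htwo hsing
  have hne := ordZero_ne_of_mohWindowSurfaceAt hR h3 hxyz κ hrat hij htwo hclean hwin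
  exact ⟨lt_of_le_of_ne hle (fun h => hne h.symm),
    MohWindowShadeAnchor.ordZero_lt_two_mul_of_mohWindowSurfaceAt₂ hx hy hz κ hij htwo hF0 hwin⟩

end MohWindowShadeAnchorOrder

end CampaignW46

end Summit.ResolutionOfSingularities.ResolutionOfSingularities.Theorems

end
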